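import Literature.Analysis.FluidPDE.AdditiveNoiseCharacteristics
import Literature.Analysis.ODE.FlowWithin
import Literature.Analysis.ODE.GlobalExistence
import Literature.Analysis.ODE.LiouvilleFormula
import HarnessLib

/-!
# Differentiability in the initial point of noise-perturbed Lagrangian trajectories
(the variational equation for JS24 Def. 2.6, pathwise)

Topic `Literature/Analysis/FluidPDE` (theorems only). Sequel to `AdditiveNoiseCharacteristics`:
for a drift `u` jointly smooth on `[a,b] × T^d`, a continuous shift `c : [a,b] → ℝ^d` (for the
backward stochastic flow of Johansson–Sorella, arXiv:2409.03599, Def. 2.6, `c(s) = w(s) - w(t₀)`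
with `w = √(2κ) W(ω)` a Brownian path) and a family `Y y` of solutions of the pathwise equation
`Y' = u(s, Y + c(s))` within `[a,b]`, `Y y t₀ = y`, the map `y ↦ Y y τ` is differentiable at every
`y ∈ ℝ^d`, with derivative the solution `J τ` of the linearised (variational) equation
`J' = D(lift u(s))(Y y s + c(s)) ∘ J`, `J t₀ = id` (`Torus.hasFDerivAt_noisyFlow`), and such a `J`
exists on `[a,b]` (`Torus.exists_solution_linear_Icc`). The field is only CONTINUOUS in time
(a Brownian path is nowhere differentiable), so the tree's smooth-dependence theorems for
autonomous / jointly smooth fields (`Literature/Analysis/ODE/FlowWithin.lean`,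
`TorusBackwardFlow.lean`) do not apply verbatim; instead the classical Grönwall argument
(Hartman, *ODE*, Ch. V Thm. 3.1; Lang 1995, Ch. IV §1 Thm. 1.14) is run with the GLOBAL bounds
that periodicity provides: `‖D lift u(s)‖ ≤ M₁` and `z ↦ D lift u(s)(z)` is `M₂`-Lipschitz,
uniformly in `s ∈ [a,b]` (`Torus.exists_norm_fderiv_lift_le_Icc`,
`Torus.exists_lipschitz_fderiv_lift`), whence the second-order Taylor remainder
`‖u(q) - u(p) - Du(p)(q-p)‖ ≤ M₂‖q-p‖²` and an `O(‖y'-y‖²)` Grönwall bound for the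
linearisation error, two-sided in time (`Torus.norm_le_gronwallBound_two_sided`).

Moreover: `Torus.exists_hasFDerivAt_noisyFlow` (the linearisation exists, so the flow maps
are differentiable everywhere), `Torus.det_linearization_eq_one` (**Liouville**: for
divergence-free drifts `det J ≡ 1`, by Jacobi's formula
`Literature.Analysis.ODE.hasDerivWithinAt_det_of_pointwise` and `tr D(lift u) = div u`,
`divergence_eq_trace_fderiv`), and `Torus.noisyFlow_injective` / `Torus.noisyFlow_surjective`
(the time-`τ` maps are bijections of `ℝ^d`). These are the inputs of the change-of-variables
formula; the measure preservation of the induced torus maps (used in Lemma 2.8 of the source) is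
not treated here.

## References

* C. J. P. Johansson, M. Sorella, arXiv:2409.03599v2 (2024), Def. 2.6, §2.2. [`JohanssonSorella2024`]
* P. Hartman, *Ordinary Differential Equations* (2nd ed. 1982 / SIAM 2002), Ch. V, Thm. 3.1
  (differentiability with respect to initial conditions; the variational equation). [folklore]
* S. Lang, *Differential and Riemannian Manifolds* (1995), Ch. IV §1, Thm. 1.14. [`Lang1995`]
-/

noncomputable section

open MeasureTheory Set Filter Metric Function
open scoped NNReal ENNReal ContDiff Topology

namespace Literature.Analysis.FluidPDE

namespace Torus

open FunctionSpaces FunctionSpaces.Torus Literature.Analysis.ODE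

variable {d : Type*} [Fintype d]

/-! ## Global first- and second-order bounds for lifted smooth drifts -/

section Bounds

variable [DecidableEq d] {a b : ℝ} {u : ℝ → UnitAddTorus d → EuclideanSpace ℝ d}

/-- **Uniform bound on the spatial derivative.** For `u` jointly smooth on `[a,b] × T^d`, `a < b`,
`‖D(lift u(s))(z)‖ ≤ M` for all `s ∈ [a,b]`, `z ∈ ℝ^d` (bounded partial derivatives,
`norm_fderiv_lift_le_of_norm_partialDeriv_le`). [folklore] -/
theorem exists_norm_fderiv_lift_le_Icc (hab : a < b) (hu : IsSmoothSpaceTimeOn (Icc a b) u) :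
    ∃ M : ℝ, 0 ≤ M ∧ ∀ s ∈ Icc a b, ∀ z : EuclideanSpace ℝ d,
      ‖_root_.fderiv ℝ (lift (u s)) z‖ ≤ M := by
  have hS' : UniqueDiffOn ℝ (Icc a b) := uniqueDiffOn_Icc hab
  choose C hC using fun i => (hu.partialDeriv hS' i).exists_norm_le_of_isCompact isCompact_Icc subset_rfl
  have hC0 : 0 ≤ ∑ i, C i := Finset.sum_nonneg fun i _ =>
    (norm_nonneg _).trans (hC i a (left_mem_Icc.2 hab.le) 0)
  refine ⟨∑ i, C i, hC0, fun s hs z => ?_⟩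
  exact norm_fderiv_lift_le_of_norm_partialDeriv_le ((hu.isSmooth_slice hs).isContDiff (by simp))
    (fun i x => hC i s hs x) z

/-- The derivative of a lift, expanded in lifted partial derivatives:
`D(lift g)(z) w = ∑ᵢ wᵢ • lift (∂ᵢ g) z`. [folklore] -/
theorem fderiv_lift_apply_eq_sum {g : UnitAddTorus d → EuclideanSpace ℝ d} (hg : IsContDiff 1 g)
    (z w : EuclideanSpace ℝ d) :
    _root_.fderiv ℝ (lift g) z w = ∑ i, w i • lift (fun x => partialDeriv i g x) z := by
  rw [fderiv_lift, fderiv_apply_eq_sum_partialDeriv hg]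
  rfl

/-- **Uniform Lipschitz bound on the spatial derivative** (bounded second derivatives): for `u`
jointly smooth on `[a,b] × T^d`, `a < b`, there is `L ≥ 0` with
`‖D(lift u(s))(z) - D(lift u(s))(z')‖ ≤ L ‖z - z'‖` for all `s ∈ [a,b]` (each lifted partial
derivative `lift (∂ᵢ u(s))` is Lipschitz uniformly in `s`, by
`exists_lipschitzWith_lift_of_isSmoothSpaceTimeOn` applied to the jointly smooth field `∂ᵢ u`).
[folklore] -/
theorem exists_lipschitz_fderiv_lift (hab : a < b) (hu : IsSmoothSpaceTimeOn (Icc a b) u) :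
    ∃ L : ℝ, 0 ≤ L ∧ ∀ s ∈ Icc a b, ∀ z z' : EuclideanSpace ℝ d,
      ‖_root_.fderiv ℝ (lift (u s)) z - _root_.fderiv ℝ (lift (u s)) z'‖ ≤ L * ‖z - z'‖ := by
  have hS' : UniqueDiffOn ℝ (Icc a b) := uniqueDiffOn_Icc hab
  choose K hK using fun i =>
    exists_lipschitzWith_lift_of_isSmoothSpaceTimeOn hab (hu.partialDeriv hS' i)
  refine ⟨∑ i, (K i : ℝ), Finset.sum_nonneg fun i _ => (K i).2, fun s hs z z' => ?_⟩
  have h1 : IsContDiff 1 (u s) := (hu.isSmooth_slice hs).isContDiff (by simp)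
  refine ContinuousLinearMap.opNorm_le_bound _ (by positivity) fun w => ?_
  rw [FunLike.coe_sub, Pi.sub_apply, fderiv_lift_apply_eq_sum h1,
    fderiv_lift_apply_eq_sum h1, ← Finset.sum_sub_distrib]
  calc ‖∑ i, (w i • lift (fun x => partialDeriv i (u s) x) z -
          w i • lift (fun x => partialDeriv i (u s) x) z')‖
        ≤ ∑ i, ‖w i • lift (fun x => partialDeriv i (u s) x) z -
          w i • lift (fun x => partialDeriv i (u s) x) z'‖ := norm_sum_le _ _
    _ ≤ ∑ i, ‖w‖ * ((K i : ℝ) * ‖z - z'‖) := Finset.sum_le_sum fun i _ => by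
        rw [← smul_sub, norm_smul]
        refine mul_le_mul (by simpa using PiLp.norm_apply_le w i) ?_ (norm_nonneg _) (norm_nonneg _)
        rw [← dist_eq_norm, ← dist_eq_norm]
        exact (hK i s hs).dist_le_mul z z'
    _ = (∑ i, (K i : ℝ)) * ‖z - z'‖ * ‖w‖ := by
        rw [← Finset.mul_sum, ← Finset.sum_mul]; ring

omit [DecidableEq d] in
/-- **Second-order Taylor remainder from a Lipschitz derivative**: if `z ↦ D(lift g)(z)` is
`L`-Lipschitz then `‖g(q) - g(p) - Dg(p)(q - p)‖ ≤ L ‖q - p‖²` (mean value inequality on the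
segment, Mathlib `Convex.norm_image_sub_le_of_norm_hasFDerivWithin_le'`). [folklore] -/
theorem norm_lift_sub_sub_fderiv_le {g : UnitAddTorus d → EuclideanSpace ℝ d} (hg : IsContDiff 1 g)
    {L : ℝ} (hL0 : 0 ≤ L) (hL : ∀ z z' : EuclideanSpace ℝ d,
      ‖_root_.fderiv ℝ (lift g) z - _root_.fderiv ℝ (lift g) z'‖ ≤ L * ‖z - z'‖)
    (p q : EuclideanSpace ℝ d) :
    ‖lift g q - lift g p - _root_.fderiv ℝ (lift g) p (q - p)‖ ≤ L * ‖q - p‖ ^ 2 := by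
  have hdiff : Differentiable ℝ (lift g) := hg.differentiable one_ne_zero
  have h := (convex_closedBall p ‖q - p‖).norm_image_sub_le_of_norm_hasFDerivWithin_le'
    (f := lift g) (f' := fun z => _root_.fderiv ℝ (lift g) z) (φ := _root_.fderiv ℝ (lift g) p)
    (fun z _ => (hdiff z).hasFDerivAt.hasFDerivWithinAt)
    (fun z hz => (hL z p).trans (mul_le_mul_of_nonneg_left (mem_closedBall_iff_norm.1 hz) hL0))
    (mem_closedBall_self (norm_nonneg _)) (mem_closedBall_iff_norm.2 le_rfl)
  calc ‖lift g q - lift g p - _root_.fderiv ℝ (lift g) p (q - p)‖ ≤ L * ‖q - p‖ * ‖q - p‖ := h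
    _ = L * ‖q - p‖ ^ 2 := by ring

omit [DecidableEq d] in
/-- **Joint continuity of the spatial derivative** of a jointly smooth field:
`(s, z) ↦ D(lift u(s))(z)` is continuous on `[a,b] × ℝ^d`, `a < b` (it is the space–time derivative
of the lift composed with the inclusion `w ↦ (0, w)`, `IsSmoothSpaceTimeOn.fderiv_slice_apply`).
[folklore] -/
theorem continuousOn_fderiv_lift (hab : a < b) (hu : IsSmoothSpaceTimeOn (Icc a b) u) :
    ContinuousOn (fun p : ℝ × EuclideanSpace ℝ d => _root_.fderiv ℝ (lift (u p.1)) p.2)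
      (Icc a b ×ˢ univ) := by
  have hU : UniqueDiffOn ℝ (Icc a b ×ˢ (univ : Set (EuclideanSpace ℝ d))) :=
    (uniqueDiffOn_Icc hab).prod uniqueDiffOn_univ
  have hc : ContinuousOn (fun p : ℝ × EuclideanSpace ℝ d =>
      (fderivWithin ℝ (stLift u) (Icc a b ×ˢ univ) p).comp
        (ContinuousLinearMap.inr ℝ ℝ (EuclideanSpace ℝ d))) (Icc a b ×ˢ univ) :=
    ((ContinuousLinearMap.compL ℝ (EuclideanSpace ℝ d) (ℝ × EuclideanSpace ℝ d)
      (EuclideanSpace ℝ d)).flip (ContinuousLinearMap.inr ℝ ℝ (EuclideanSpace ℝ d))).continuous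
      |>.comp_continuousOn (hu.continuousOn_fderivWithin hU (by simp))
  refine hc.congr fun p hp => ?_
  obtain ⟨s, z⟩ := p
  have hs : s ∈ Icc a b := (mem_prod.1 hp).1
  refine ContinuousLinearMap.ext fun w => ?_
  change _root_.fderiv ℝ (lift (u s)) z w = fderivWithin ℝ (stLift u) (Icc a b ×ˢ univ) (s, z) ((0 : ℝ), w)
  rw [fderiv_lift, hu.fderiv_slice_apply hs]

end Bounds

/-! ## The linearised equation on `[a,b]`, two-sided from `t₀` -/

section Linear

variable {E : Type*} [NormedAddCommGroup E] [NormedSpace ℝ E] [CompleteSpace E] {a b t₀ : ℝ}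

/-- **Global solutions of `J' = A(s) ∘ J` on `[a,b]` with `J t₀ = id`**, for `A` continuous on
`[a,b]` and any `t₀ ∈ [a,b]`: the forward solution on `[t₀, b]` and the backward one on `[a, t₀]`
(both from `Literature.Analysis.ODE.exists_solution_linear` after a time shift, resp. a time
reversal `A ↦ -A(t₀ - ·)`), glued at `t₀` (`Literature.Analysis.ODE.solution_append`).
[folklore] -/
theorem exists_solution_linear_Icc {A : ℝ → E →L[ℝ] E} (hA : ContinuousOn A (Icc a b))
    (ht₀ : t₀ ∈ Icc a b) :
    ∃ J : ℝ → E →L[ℝ] E, J t₀ = 1 ∧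
      ∀ s ∈ Icc a b, HasDerivWithinAt J ((A s).comp (J s)) (Icc a b) s := by
  -- forward piece on `[t₀, b]`
  have hAf : ContinuousOn (fun τ => A (t₀ + τ)) (Icc 0 (b - t₀)) :=
    hA.comp (continuous_const.add continuous_id).continuousOn fun τ hτ =>
      show t₀ + τ ∈ Icc a b from ⟨by linarith [ht₀.1, hτ.1], by linarith [hτ.2]⟩
  obtain ⟨Jf, hJf0, hJf⟩ := exists_solution_linear (sub_nonneg.2 ht₀.2) hAf (1 : E →L[ℝ] E)
  have hF : ∀ s ∈ Icc t₀ b, HasDerivWithinAt (fun s => Jf (s - t₀)) ((A s).comp (Jf (s - t₀)))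
      (Icc t₀ b) s := by
    intro s hs
    have hmem : s - t₀ ∈ Icc 0 (b - t₀) := ⟨by linarith [hs.1], by linarith [hs.2]⟩
    have h1 := hJf (s - t₀) hmem
    have h2 : HasDerivWithinAt (fun s : ℝ => s - t₀) (1 : ℝ) (Icc t₀ b) s :=
      (hasDerivWithinAt_id s _).sub_const t₀
    have hmaps : MapsTo (fun s : ℝ => s - t₀) (Icc t₀ b) (Icc 0 (b - t₀)) := fun σ hσ =>
      ⟨by linarith [hσ.1], by linarith [hσ.2]⟩
    have h := h1.scomp s h2 hmaps
    have heq : ((1 : ℝ) • (A (t₀ + (s - t₀))).comp (Jf (s - t₀))) = (A s).comp (Jf (s - t₀)) := by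
      rw [one_smul, add_sub_cancel]
    rw [heq] at h
    exact h
  -- backward piece on `[a, t₀]`
  have hAb : ContinuousOn (fun τ => -A (t₀ - τ)) (Icc 0 (t₀ - a)) :=
    (hA.comp (continuous_const.sub continuous_id).continuousOn fun τ hτ =>
      show t₀ - τ ∈ Icc a b from ⟨by linarith [hτ.2], by linarith [ht₀.2, hτ.1]⟩).neg
  obtain ⟨Jb, hJb0, hJb⟩ := exists_solution_linear (sub_nonneg.2 ht₀.1) hAb (1 : E →L[ℝ] E)
  have hB : ∀ s ∈ Icc a t₀, HasDerivWithinAt (fun s => Jb (t₀ - s)) ((A s).comp (Jb (t₀ - s)))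
      (Icc a t₀) s := by
    intro s hs
    have hmem : t₀ - s ∈ Icc 0 (t₀ - a) := ⟨by linarith [hs.2], by linarith [hs.1]⟩
    have h1 := hJb (t₀ - s) hmem
    have h2 : HasDerivWithinAt (fun s : ℝ => t₀ - s) (-1 : ℝ) (Icc a t₀) s :=
      (hasDerivWithinAt_id s _).const_sub t₀
    have hmaps : MapsTo (fun s : ℝ => t₀ - s) (Icc a t₀) (Icc 0 (t₀ - a)) := fun σ hσ =>
      ⟨by linarith [hσ.2], by linarith [hσ.1]⟩
    have h := h1.scomp s h2 hmaps
    have heq : ((-1 : ℝ) • (-A (t₀ - (t₀ - s))).comp (Jb (t₀ - s))) = (A s).comp (Jb (t₀ - s)) := by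
      rw [sub_sub_cancel, ContinuousLinearMap.neg_comp, smul_neg, neg_smul, one_smul, neg_neg]
    rw [heq] at h
    exact h
  -- glue
  have hglue := solution_append (v := fun s (B : E →L[ℝ] E) => (A s).comp B) hB hF ht₀.1 ht₀.2
    (by simp [hJf0, hJb0])
  refine ⟨fun s => if s ≤ t₀ then Jb (t₀ - s) else Jf (s - t₀), by simp [hJb0], hglue⟩

end Linear

/-! ## Two-sided Grönwall bound -/

section Gronwall

variable {E : Type*} [NormedAddCommGroup E] [NormedSpace ℝ E] {a b t₀ : ℝ}

/-- Forward Grönwall for derivatives within `[a,b]`: from `t₀` to the right. [folklore] -/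
theorem norm_le_gronwallBound_right {e e' : ℝ → E} {K C : ℝ}
    (he : ∀ s ∈ Icc a b, HasDerivWithinAt e (e' s) (Icc a b) s)
    (hbound : ∀ s ∈ Icc a b, ‖e' s‖ ≤ K * ‖e s‖ + C) (ht₀ : t₀ ∈ Icc a b) {τ : ℝ}
    (hτ : τ ∈ Icc a b) (htτ : t₀ ≤ τ) :
    ‖e τ‖ ≤ gronwallBound ‖e t₀‖ K C (τ - t₀) := by
  have hsub : Icc t₀ τ ⊆ Icc a b := Icc_subset_Icc ht₀.1 hτ.2
  have hcont : ContinuousOn e (Icc t₀ τ) := fun s hs => ((he s (hsub hs)).continuousWithinAt).mono hsub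
  have hder : ∀ s ∈ Ico t₀ τ, HasDerivWithinAt e (e' s) (Ici s) s := fun s hs =>
    (he s (hsub (Ico_subset_Icc_self hs))).mono_of_mem_nhdsWithin
      (Icc_mem_nhdsGE_of_mem ⟨ht₀.1.trans hs.1, hs.2.trans_le hτ.2⟩)
  exact norm_le_gronwallBound_of_norm_deriv_right_le hcont hder le_rfl
    (fun s hs => hbound s (hsub (Ico_subset_Icc_self hs))) τ ⟨htτ, le_rfl⟩

/-- **Two-sided Grönwall bound within `[a,b]`**: if `‖e'‖ ≤ K ‖e‖ + C` on `[a,b]` (derivatives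
within `[a,b]`), then `‖e τ‖ ≤ gronwallBound ‖e t₀‖ K C |τ - t₀|` for all `τ, t₀ ∈ [a,b]`
(forward: Mathlib `norm_le_gronwallBound_of_norm_deriv_right_le`; backward: the same for
`σ ↦ e(-σ)`). [folklore] -/
theorem norm_le_gronwallBound_two_sided {e e' : ℝ → E} {K C : ℝ}
    (he : ∀ s ∈ Icc a b, HasDerivWithinAt e (e' s) (Icc a b) s)
    (hbound : ∀ s ∈ Icc a b, ‖e' s‖ ≤ K * ‖e s‖ + C) (ht₀ : t₀ ∈ Icc a b) {τ : ℝ}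
    (hτ : τ ∈ Icc a b) :
    ‖e τ‖ ≤ gronwallBound ‖e t₀‖ K C |τ - t₀| := by
  rcases le_or_gt t₀ τ with htτ | hτt
  · rw [abs_of_nonneg (sub_nonneg.2 htτ)]
    exact norm_le_gronwallBound_right he hbound ht₀ hτ htτ
  · rw [abs_of_neg (sub_neg.2 hτt), neg_sub]
    -- time reversal
    have hrev : ∀ σ ∈ Icc (-b) (-a), HasDerivWithinAt (fun σ => e (-σ)) (-(e' (-σ))) (Icc (-b) (-a)) σ := by
      intro σ hσ
      have hmem : -σ ∈ Icc a b := ⟨by linarith [hσ.2], by linarith [hσ.1]⟩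
      have hneg : HasDerivWithinAt (fun σ : ℝ => -σ) (-1 : ℝ) (Icc (-b) (-a)) σ :=
        (hasDerivWithinAt_id σ _).neg
      have hmaps : MapsTo (fun σ : ℝ => -σ) (Icc (-b) (-a)) (Icc a b) := fun ρ hρ =>
        ⟨by linarith [hρ.2], by linarith [hρ.1]⟩
      have h := (he (-σ) hmem).scomp σ hneg hmaps
      rw [neg_one_smul] at h
      exact h
    have hbound' : ∀ σ ∈ Icc (-b) (-a), ‖-(e' (-σ))‖ ≤ K * ‖e (-σ)‖ + C := fun σ hσ => by
      rw [norm_neg]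
      exact hbound (-σ) ⟨by linarith [hσ.2], by linarith [hσ.1]⟩
    have h := norm_le_gronwallBound_right (e := fun σ => e (-σ)) hrev hbound'
      (t₀ := -t₀) ⟨by linarith [ht₀.2], by linarith [ht₀.1]⟩
      (τ := -τ) ⟨by linarith [hτ.2], by linarith [hτ.1]⟩ (by linarith)
    simp only [neg_neg] at h
    convert h using 2
    ring

end Gronwall

/-! ## The variational equation for noise-perturbed characteristics -/

section Variational

variable [DecidableEq d] {a b t₀ : ℝ} {u : ℝ → UnitAddTorus d → EuclideanSpace ℝ d}
  {c : ℝ → EuclideanSpace ℝ d}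

/-- **Differentiability of the noisy Lagrangian flow in the initial point (variational
equation).** Let `u` be jointly smooth on `[a,b] × T^d`, `a < b`, `c` continuous on `[a,b]`,
`t₀ ∈ [a,b]`, and `Y y` (`y ∈ ℝ^d`) solutions of `Y' = u(s, Y + c(s))` within `[a,b]` with
`Y y t₀ = y` (for `c = w - w(t₀)` these are the pathwise backward/forward stochastic trajectories
of JS24 Def. 2.6, `Torus.exists_noisyFlow`). If `J` solves the linearised equation
`J' = D(lift u(s))(Y y s + c(s)) ∘ J` within `[a,b]` with `J t₀ = id`, then `y' ↦ Y y' τ` has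
Fréchet derivative `J τ` at `y`, for every `τ ∈ [a,b]`. Proof: the error
`e = Y y' - Y y - J (y' - y)` has `e(t₀) = 0` and
`‖e'‖ ≤ M₁ ‖e‖ + M₂ e^{2K(b-a)} ‖y' - y‖²` by the second-order Taylor remainder and the
Lipschitz dependence `Torus.dist_noisyCharacteristic_le`; two-sided Grönwall.
[cite: JohanssonSorella2024, Def. 2.6, §2.2] -/
theorem hasFDerivAt_noisyFlow (hab : a < b) (hu : IsSmoothSpaceTimeOn (Icc a b) u)
    (ht₀ : t₀ ∈ Icc a b) {Y : EuclideanSpace ℝ d → ℝ → EuclideanSpace ℝ d} (hY0 : ∀ y, Y y t₀ = y)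
    (hY : ∀ y, ∀ s ∈ Icc a b, HasDerivWithinAt (Y y) (lift (u s) (Y y s + c s)) (Icc a b) s)
    {y : EuclideanSpace ℝ d} {J : ℝ → EuclideanSpace ℝ d →L[ℝ] EuclideanSpace ℝ d} (hJ0 : J t₀ = 1)
    (hJ : ∀ s ∈ Icc a b, HasDerivWithinAt J
      ((_root_.fderiv ℝ (lift (u s)) (Y y s + c s)).comp (J s)) (Icc a b) s)
    {τ : ℝ} (hτ : τ ∈ Icc a b) :
    HasFDerivAt (fun y' => Y y' τ) (J τ) y := by
  -- global bounds
  obtain ⟨K, hK⟩ := exists_lipschitzWith_lift_of_isSmoothSpaceTimeOn hab hu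
  obtain ⟨M₁, hM₁0, hM₁⟩ := exists_norm_fderiv_lift_le_Icc hab hu
  obtain ⟨M₂, hM₂0, hM₂⟩ := exists_lipschitz_fderiv_lift hab hu
  set Cexp : ℝ := Real.exp (K * (b - a)) with hCexp
  -- Lipschitz dependence on the initial point (with the shift `c`)
  have hKc : ∀ s ∈ Icc a b, LipschitzWith K (fun z => lift (u s) (z + c s)) := fun s hs z z' => by
    have h := hK s hs (z + c s) (z' + c s)
    rwa [edist_add_right] at h
  have hLip : ∀ s ∈ Icc a b, ∀ y', ‖Y y' s - Y y s‖ ≤ ‖y' - y‖ * Cexp := by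
    intro s hs y'
    have h := dist_trajectories_le_two_sided (v := fun s z => lift (u s) (z + c s)) hKc (hY y')
      (hY y) ht₀ hs
    rw [hY0, hY0, dist_eq_norm, dist_eq_norm] at h
    refine h.trans (mul_le_mul_of_nonneg_left (Real.exp_le_exp.2 ?_) (norm_nonneg _))
    exact mul_le_mul_of_nonneg_left
      (abs_le.2 ⟨by linarith [hs.1, ht₀.2], by linarith [hs.2, ht₀.1]⟩) K.2
  -- the Grönwall constant of the quadratic error bound
  set Q : ℝ := gronwallBound 0 M₁ 1 (b - a) with hQ
  have hQ0 : 0 ≤ Q := by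
    have := gronwallBound_mono (δ := 0) (K := M₁) (ε := 1) le_rfl zero_le_one hM₁0
      (sub_nonneg.2 hab.le)
    rwa [gronwallBound_x0] at this
  set D : ℝ := M₂ * Cexp ^ 2 * Q with hD
  have hD0 : 0 ≤ D := by positivity
  rw [hasFDerivAt_iff_isLittleO_nhds_zero, Asymptotics.isLittleO_iff]
  intro ε hε
  rw [Metric.eventually_nhds_iff]
  refine ⟨ε / (D + 1), div_pos hε (by positivity), fun h hh => ?_⟩
  rw [dist_zero_right] at hh
  -- the error function
  set e : ℝ → EuclideanSpace ℝ d := fun s => Y (y + h) s - Y y s - J s h with he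
  have he0 : e t₀ = 0 := by simp [he, hY0, hJ0]
  have hederiv : ∀ s ∈ Icc a b, HasDerivWithinAt e
      (lift (u s) (Y (y + h) s + c s) - lift (u s) (Y y s + c s) -
        (_root_.fderiv ℝ (lift (u s)) (Y y s + c s)) (J s h)) (Icc a b) s := by
    intro s hs
    have h3 : HasDerivWithinAt (fun σ => J σ h)
        ((_root_.fderiv ℝ (lift (u s)) (Y y s + c s)).comp (J s) h) (Icc a b) s := by
      simpa using (hJ s hs).clm_apply (hasDerivWithinAt_const s (Icc a b) h)
    exact ((hY (y + h) s hs).sub (hY y s hs)).sub h3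
  have hbound : ∀ s ∈ Icc a b,
      ‖lift (u s) (Y (y + h) s + c s) - lift (u s) (Y y s + c s) -
        (_root_.fderiv ℝ (lift (u s)) (Y y s + c s)) (J s h)‖ ≤
        M₁ * ‖e s‖ + M₂ * Cexp ^ 2 * ‖h‖ ^ 2 := by
    intro s hs
    have h1 : IsContDiff 1 (u s) := (hu.isSmooth_slice hs).isContDiff (by simp)
    have hsplit : lift (u s) (Y (y + h) s + c s) - lift (u s) (Y y s + c s) -
        (_root_.fderiv ℝ (lift (u s)) (Y y s + c s)) (J s h) =
        (lift (u s) (Y (y + h) s + c s) - lift (u s) (Y y s + c s) -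
          (_root_.fderiv ℝ (lift (u s)) (Y y s + c s)) ((Y (y + h) s + c s) - (Y y s + c s))) +
        (_root_.fderiv ℝ (lift (u s)) (Y y s + c s)) (e s) := by
      rw [show e s = Y (y + h) s - Y y s - J s h from rfl]
      simp only [map_sub, map_add]
      abel
    rw [hsplit]
    refine (norm_add_le _ _).trans ?_
    rw [add_comm (M₁ * ‖e s‖)]
    refine add_le_add ?_ ((_root_.fderiv ℝ (lift (u s)) (Y y s + c s)).le_of_opNorm_le
      (hM₁ s hs _) (e s))
    refine (norm_lift_sub_sub_fderiv_le h1 hM₂0 (hM₂ s hs) _ _).trans ?_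
    have hqp : ‖(Y (y + h) s + c s) - (Y y s + c s)‖ ≤ ‖h‖ * Cexp := by
      rw [add_sub_add_right_eq_sub]
      simpa using hLip s hs (y + h)
    calc M₂ * ‖(Y (y + h) s + c s) - (Y y s + c s)‖ ^ 2 ≤ M₂ * (‖h‖ * Cexp) ^ 2 := by gcongr
      _ = M₂ * Cexp ^ 2 * ‖h‖ ^ 2 := by ring
  -- two-sided Grönwall
  have hgron := norm_le_gronwallBound_two_sided hederiv hbound ht₀ hτ
  rw [he0, norm_zero] at hgron
  have hx : |τ - t₀| ≤ b - a := abs_le.2 ⟨by linarith [hτ.1, ht₀.2], by linarith [hτ.2, ht₀.1]⟩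
  have hfinal : gronwallBound 0 M₁ (M₂ * Cexp ^ 2 * ‖h‖ ^ 2) |τ - t₀| ≤ D * ‖h‖ ^ 2 := by
    rw [show M₂ * Cexp ^ 2 * ‖h‖ ^ 2 = (M₂ * Cexp ^ 2 * ‖h‖ ^ 2) * 1 by ring, gronwallBound_zero_mul]
    have hmono : gronwallBound 0 M₁ 1 |τ - t₀| ≤ Q :=
      gronwallBound_mono (δ := 0) (K := M₁) (ε := 1) le_rfl zero_le_one hM₁0 hx
    calc M₂ * Cexp ^ 2 * ‖h‖ ^ 2 * gronwallBound 0 M₁ 1 |τ - t₀|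
        ≤ M₂ * Cexp ^ 2 * ‖h‖ ^ 2 * Q := mul_le_mul_of_nonneg_left hmono (by positivity)
      _ = D * ‖h‖ ^ 2 := by rw [hD]; ring
  have hhD : D * ‖h‖ ≤ ε := by
    have h1 : D * ‖h‖ ≤ D * (ε / (D + 1)) := mul_le_mul_of_nonneg_left hh.le hD0
    refine h1.trans ?_
    rw [mul_div_assoc', div_le_iff₀ (by positivity)]
    nlinarith
  calc ‖Y (y + h) τ - Y y τ - J τ h‖ = ‖e τ‖ := rfl
    _ ≤ D * ‖h‖ ^ 2 := hgron.trans hfinal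
    _ = D * ‖h‖ * ‖h‖ := by ring
    _ ≤ ε * ‖h‖ := mul_le_mul_of_nonneg_right hhD (norm_nonneg _)

/-- **The linearisation exists and is the derivative.** Under the hypotheses of
`hasFDerivAt_noisyFlow` with `c` continuous on `[a,b]`, for every `y` there is `J` with
`J t₀ = id`, `J' = D(lift u(s))(Y y s + c(s)) ∘ J` within `[a,b]`, and
`D(y' ↦ Y y' τ)(y) = J τ` for all `τ ∈ [a,b]` (`exists_solution_linear_Icc`, the coefficient being
continuous by `continuousOn_fderiv_lift`). [folklore] -/
theorem exists_hasFDerivAt_noisyFlow (hab : a < b) (hu : IsSmoothSpaceTimeOn (Icc a b) u)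
    (hc : ContinuousOn c (Icc a b)) (ht₀ : t₀ ∈ Icc a b)
    {Y : EuclideanSpace ℝ d → ℝ → EuclideanSpace ℝ d} (hY0 : ∀ y, Y y t₀ = y)
    (hY : ∀ y, ∀ s ∈ Icc a b, HasDerivWithinAt (Y y) (lift (u s) (Y y s + c s)) (Icc a b) s)
    (y : EuclideanSpace ℝ d) :
    ∃ J : ℝ → EuclideanSpace ℝ d →L[ℝ] EuclideanSpace ℝ d, J t₀ = 1 ∧
      (∀ s ∈ Icc a b, HasDerivWithinAt J
        ((_root_.fderiv ℝ (lift (u s)) (Y y s + c s)).comp (J s)) (Icc a b) s) ∧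
      ∀ τ ∈ Icc a b, HasFDerivAt (fun y' => Y y' τ) (J τ) y := by
  have hA : ContinuousOn (fun s => _root_.fderiv ℝ (lift (u s)) (Y y s + c s)) (Icc a b) := by
    have hYc : ContinuousOn (Y y) (Icc a b) := fun s hs => (hY y s hs).continuousWithinAt
    have hc2 : ContinuousOn (fun s => ((s, Y y s + c s) : ℝ × EuclideanSpace ℝ d)) (Icc a b) :=
      continuousOn_id.prodMk (hYc.add hc)
    exact (continuousOn_fderiv_lift hab hu).comp hc2 fun s hs => mk_mem_prod hs (mem_univ _)
  obtain ⟨J, hJ0, hJ⟩ := exists_solution_linear_Icc hA ht₀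
  exact ⟨J, hJ0, hJ, fun τ hτ => hasFDerivAt_noisyFlow hab hu ht₀ hY0 hY hJ0 hJ hτ⟩

/-- **Liouville: the Jacobian determinant of the noisy flow is `1` for divergence-free drifts.**
If `J` solves `J' = D(lift u(s))(z(s)) ∘ J` within `[a,b]` with `J t₀ = id` along any curve `z`,
and `div u(s) = 0` for `s ∈ [a,b]`, then `det J(τ) = 1` on `[a,b]`: by Jacobi's formula
(`Literature.Analysis.ODE.hasDerivWithinAt_det_of_pointwise`) `(det J)' = det J · tr D(lift u(s)) =
det J · div u(s) = 0` (`divergence_eq_trace_fderiv`), and a function with zero derivative within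
`[a,b]` is constant (two-sided Grönwall with zero constants). [folklore] -/
theorem det_linearization_eq_one (hdiv : ∀ s ∈ Icc a b, IsDivFree (u s))
    (hu : IsSmoothSpaceTimeOn (Icc a b) u) (ht₀ : t₀ ∈ Icc a b) {z : ℝ → EuclideanSpace ℝ d}
    {J : ℝ → EuclideanSpace ℝ d →L[ℝ] EuclideanSpace ℝ d} (hJ0 : J t₀ = 1)
    (hJ : ∀ s ∈ Icc a b, HasDerivWithinAt J
      ((_root_.fderiv ℝ (lift (u s)) (z s)).comp (J s)) (Icc a b) s)
    {τ : ℝ} (hτ : τ ∈ Icc a b) : (J τ).det = 1 := by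
  have hD : ∀ s ∈ Icc a b, HasDerivWithinAt (fun σ => (J σ).det - 1) (0 : ℝ) (Icc a b) s := by
    intro s hs
    have h1 : IsContDiff 1 (u s) := (hu.isSmooth_slice hs).isContDiff (by simp)
    have hpt : ∀ v, HasDerivWithinAt (fun σ => J σ v)
        ((_root_.fderiv ℝ (lift (u s)) (z s)) (J s v)) (Icc a b) s := fun v => by
      simpa using (hJ s hs).clm_apply (hasDerivWithinAt_const s (Icc a b) v)
    have h := (hasDerivWithinAt_det_of_pointwise hpt).sub_const (1 : ℝ)
    have htr : LinearMap.trace ℝ (EuclideanSpace ℝ d)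
        ((_root_.fderiv ℝ (lift (u s)) (z s) : EuclideanSpace ℝ d →L[ℝ] EuclideanSpace ℝ d) :
          EuclideanSpace ℝ d →ₗ[ℝ] EuclideanSpace ℝ d) = 0 := by
      rw [fderiv_lift, ← divergence_eq_trace_fderiv h1, hdiv s hs]
    rw [htr, mul_zero] at h
    exact h
  have hgr := norm_le_gronwallBound_two_sided (e := fun σ => (J σ).det - 1) (e' := fun _ => (0 : ℝ))
    (K := 0) (C := 0) hD (fun s _ => by simp) ht₀ hτ
  have h1 : (J t₀).det = 1 := by
    rw [hJ0]
    simp [ContinuousLinearMap.det]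
  rw [h1, sub_self, norm_zero, gronwallBound_K0] at hgr
  have h0 : ‖(J τ).det - 1‖ ≤ 0 := by simpa using hgr
  have := norm_le_zero_iff.1 h0
  linarith [sub_eq_zero.1 this]

/-- **Injectivity of the noisy flow maps** (uniqueness of characteristics through `(τ, ·)`).
[folklore] -/
theorem noisyFlow_injective (hab : a < b) (hu : IsSmoothSpaceTimeOn (Icc a b) u)
    (ht₀ : t₀ ∈ Icc a b) {Y : EuclideanSpace ℝ d → ℝ → EuclideanSpace ℝ d} (hY0 : ∀ y, Y y t₀ = y)
    (hY : ∀ y, ∀ s ∈ Icc a b, HasDerivWithinAt (Y y) (lift (u s) (Y y s + c s)) (Icc a b) s)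
    {τ : ℝ} (hτ : τ ∈ Icc a b) : Injective fun y => Y y τ := by
  obtain ⟨K, hK⟩ := exists_lipschitzWith_lift_of_isSmoothSpaceTimeOn hab hu
  have hKc : ∀ s ∈ Icc a b, LipschitzWith K (fun z => lift (u s) (z + c s)) := fun s hs z z' => by
    have h := hK s hs (z + c s) (z' + c s)
    rwa [edist_add_right] at h
  intro y₁ y₂ h12
  have h := dist_trajectories_le_two_sided (v := fun s z => lift (u s) (z + c s)) hKc (hY y₁) (hY y₂)
    hτ ht₀
  have h0 : dist (Y y₁ τ) (Y y₂ τ) = 0 := by rw [dist_eq_zero]; exact h12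
  rw [h0, zero_mul, hY0, hY0] at h
  exact dist_le_zero.1 h

/-- **Surjectivity of the noisy flow maps** (solve backwards from `(τ, z)`; existence of
characteristics through every space–time point, `Torus.exists_noisyCharacteristic`). [folklore] -/
theorem noisyFlow_surjective (hab : a < b) (hu : IsSmoothSpaceTimeOn (Icc a b) u)
    (hc : ContinuousOn c (Icc a b)) (ht₀ : t₀ ∈ Icc a b)
    {Y : EuclideanSpace ℝ d → ℝ → EuclideanSpace ℝ d} (hY0 : ∀ y, Y y t₀ = y)
    (hY : ∀ y, ∀ s ∈ Icc a b, HasDerivWithinAt (Y y) (lift (u s) (Y y s + c s)) (Icc a b) s)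
    {τ : ℝ} (hτ : τ ∈ Icc a b) : Surjective fun y => Y y τ := by
  obtain ⟨K, hK⟩ := exists_lipschitzWith_lift_of_isSmoothSpaceTimeOn hab hu
  have hKc : ∀ s ∈ Icc a b, LipschitzWith K (fun z => lift (u s) (z + c s)) := fun s hs z z' => by
    have h := hK s hs (z + c s) (z' + c s)
    rwa [edist_add_right] at h
  intro z
  -- the characteristic through `(τ, z)`, written with the shift anchored at `τ`
  obtain ⟨W, hW0, hW⟩ := exists_noisyCharacteristic (w := c) hu hK hc hτ (z + c τ)
  -- `W - c τ` solves the equation with the shift `c`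
  have hV : ∀ s ∈ Icc a b, HasDerivWithinAt (fun σ => W σ - c τ)
      (lift (u s) ((W s - c τ) + c s)) (Icc a b) s := by
    intro s hs
    have heq : (W s - c τ) + c s = W s + (c s - c τ) := by rw [sub_add_eq_add_sub, add_sub_assoc]
    rw [heq]
    exact (hW s hs).sub_const (c τ)
  refine ⟨W t₀ - c τ, ?_⟩
  show Y (W t₀ - c τ) τ = z
  -- `Y (W t₀ - c τ)` and `W - c τ` are solutions agreeing at `t₀`
  have h := dist_trajectories_le_two_sided (v := fun s z => lift (u s) (z + c s)) hKc
    (hY (W t₀ - c τ)) hV ht₀ hτ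
  rw [hY0, dist_self, zero_mul] at h
  have h' : Y (W t₀ - c τ) τ = W τ - c τ := dist_le_zero.1 h
  rw [h', hW0, add_sub_cancel_right]

end Variational

end Torus

end Literature.Analysis.FluidPDE

end
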